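import Summits.Parity.GeneralizedHardyLittlewood.Theses.LiouvilleMAD
import Summits.Parity.GeneralizedHardyLittlewood.Theorems.CosetDecorrelation.Negative.CosetDecorrelationDegenerations

/-!
# `CosetDecorrelation` (stmt-Parity-13317): trivial bound, window edges, small model

Continuation of `CosetDecorrelationDegenerations` (cdisprove seat, cycle 1; from `Cruxes/CosetDecorrelation/Disproof.lean`
§3–§4).  TIGHTNESS: `trivial_bound` (`|T| ≤ 3 M^{3/2}` in the window `j ≥ ⌊√M⌋+1`; the crux with `ϑ = 3/4` is
free).  STRENGTHENINGS: `modulus_one` (`j = 1`: `T = S(n)S(n')`, random size `M`), `large_modulus_eq_diagonal`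
(`j > M`: the coset sum IS the dilated two-point Chowla sum — extending the window upward swallows the node
`DilatedChowla`), `not_uniformConstant` (`C = 1, ϑ = 0` from `M = 1` fails at `M = 2`, where `T = −2`); SHIFT SCALING `T_scale`
(`T_j(gn,gn';gc) = T_j(n,n';c)`: the shifts `c = ±1` are the hardest instances). [folklore]
-/

namespace Summit.Parity.GeneralizedHardyLittlewood.Theorems.CosetDecorrelation.Negative

open Summit.Parity.GeneralizedHardyLittlewood.Theses.LiouvilleMAD
open Summit.Parity.GeneralizedHardyLittlewood.Theorems.CosetDecorrelation.FareyLevelMeanCoupling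
  (normalForm_coset_eq_classInner normalForm_sum_classSum)
open Finset

/-! ## §3 Tightness: the trivial bound (exponent `3/2`) -/

/-- Each class of `(M,2M]` modulo `j ≥ 1` has at most `2M/j + 1` elements (inject by `m ↦ m / j`).
(Ported from `SketchIdeator3.card_class_le`.) -/
theorem card_class_le (M j a : ℕ) (_hj : 1 ≤ j) :
    (((Ioc M (2 * M)).filter (fun m => m ≡ a [MOD j])).card : ℝ) ≤ 2 * M / j + 1 := by
  have hinj : Set.InjOn (fun m => m / j)
      (((Ioc M (2 * M)).filter (fun m => m ≡ a [MOD j]) : Finset ℕ) : Set ℕ) := by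
    intro m hm m' hm' h
    rw [mem_coe, mem_filter] at hm hm'
    have hmod : m % j = m' % j := hm.2.trans hm'.2.symm
    have h' : m / j = m' / j := h
    calc m = j * (m / j) + m % j := (Nat.div_add_mod m j).symm
      _ = j * (m' / j) + m' % j := by rw [h', hmod]
      _ = m' := Nat.div_add_mod m' j
  have hmaps : Set.MapsTo (fun m => m / j)
      (((Ioc M (2 * M)).filter (fun m => m ≡ a [MOD j]) : Finset ℕ) : Set ℕ)
      ((range (2 * M / j + 1) : Finset ℕ) : Set ℕ) := by
    intro m hm
    rw [mem_coe, mem_filter, mem_Ioc] at hm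
    rw [mem_coe, mem_range]
    exact Nat.lt_succ_of_le (Nat.div_le_div_right hm.1.2)
  have hcard := card_le_card_of_injOn (fun m => m / j) hmaps hinj
  rw [card_range] at hcard
  have hdiv : ((2 * M / j : ℕ) : ℝ) ≤ 2 * (M : ℝ) / j := by
    have := Nat.cast_div_le (m := 2 * M) (n := j) (α := ℝ)
    push_cast at this
    exact this
  calc (((Ioc M (2 * M)).filter (fun m => m ≡ a [MOD j])).card : ℝ)
      ≤ ((2 * M / j + 1 : ℕ) : ℝ) := by exact_mod_cast hcard
    _ = ((2 * M / j : ℕ) : ℝ) + 1 := by push_cast; ring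
    _ ≤ 2 * (M : ℝ) / j + 1 := by linarith

/-- The classes partition `(M,2M]`: `Σ_{a<j} #class_a = M`. (Ported from `SketchIdeator3`.) -/
theorem sum_card_class (M j : ℕ) (hj : 1 ≤ j) :
    ∑ a ∈ range j, (((Ioc M (2 * M)).filter (fun m => m ≡ a [MOD j])).card : ℝ) = M := by
  have h := normalForm_sum_classSum (fun _ => (1 : ℝ)) M j hj
  simp only [sum_const, nsmul_eq_mul, mul_one, Nat.card_Ioc] at h
  rw [h, show 2 * M - M = M by omega]

/-- `|A_f(a)| ≤ #class_a` for weights bounded by `1`. -/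
theorem abs_classSum_le (f : ℕ → ℝ) (hf : ∀ m, |f m| ≤ 1) (M j a : ℕ) :
    |∑ m ∈ (Ioc M (2 * M)).filter (fun m => m ≡ a [MOD j]), f m|
      ≤ (((Ioc M (2 * M)).filter (fun m => m ≡ a [MOD j])).card : ℝ) := by
  calc |∑ m ∈ (Ioc M (2 * M)).filter (fun m => m ≡ a [MOD j]), f m|
      ≤ ∑ m ∈ (Ioc M (2 * M)).filter (fun m => m ≡ a [MOD j]), |f m| := abs_sum_le_sum_abs _ _
    _ ≤ ∑ m ∈ (Ioc M (2 * M)).filter (fun m => m ≡ a [MOD j]), (1 : ℝ) := sum_le_sum fun m _ => hf m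
    _ = _ := by simp

/-- TRIVIAL BOUND (general weights bounded by `1`): `|cosetW f g M j| ≤ (2M/j + 1)·M`. -/
theorem abs_cosetW_le (f g : ℕ → ℝ) (hf : ∀ m, |f m| ≤ 1) (hg : ∀ m, |g m| ≤ 1) (M j : ℕ)
    (hj : 1 ≤ j) : |cosetW f g M j| ≤ (2 * (M : ℝ) / j + 1) * M := by
  rw [cosetW_eq_classInner f g M j hj]
  calc |∑ a ∈ range j, (∑ m ∈ (Ioc M (2 * M)).filter (fun m => m ≡ a [MOD j]), f m) *
          (∑ m ∈ (Ioc M (2 * M)).filter (fun m => m ≡ a [MOD j]), g m)|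
      ≤ ∑ a ∈ range j, |(∑ m ∈ (Ioc M (2 * M)).filter (fun m => m ≡ a [MOD j]), f m) *
          (∑ m ∈ (Ioc M (2 * M)).filter (fun m => m ≡ a [MOD j]), g m)| := abs_sum_le_sum_abs _ _
    _ ≤ ∑ a ∈ range j, (2 * (M : ℝ) / j + 1) *
          (((Ioc M (2 * M)).filter (fun m => m ≡ a [MOD j])).card : ℝ) := by
        refine sum_le_sum fun a _ => ?_
        rw [abs_mul]
        calc |∑ m ∈ (Ioc M (2 * M)).filter (fun m => m ≡ a [MOD j]), f m| *
              |∑ m ∈ (Ioc M (2 * M)).filter (fun m => m ≡ a [MOD j]), g m|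
            ≤ (((Ioc M (2 * M)).filter (fun m => m ≡ a [MOD j])).card : ℝ) *
                (((Ioc M (2 * M)).filter (fun m => m ≡ a [MOD j])).card : ℝ) :=
              mul_le_mul (abs_classSum_le f hf M j a) (abs_classSum_le g hg M j a) (abs_nonneg _)
                (Nat.cast_nonneg _)
          _ ≤ (2 * (M : ℝ) / j + 1) * (((Ioc M (2 * M)).filter (fun m => m ≡ a [MOD j])).card : ℝ) :=
              mul_le_mul_of_nonneg_right (card_class_le M j a hj) (Nat.cast_nonneg _)
    _ = (2 * (M : ℝ) / j + 1) * M := by rw [← mul_sum, sum_card_class M j hj]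

/-- `√M < ⌊√M⌋ + 1` as reals. -/
theorem sqrt_lt_natSqrt_add_one (M : ℕ) : Real.sqrt M < ((Nat.sqrt M + 1 : ℕ) : ℝ) := by
  have h : (M : ℝ) < ((Nat.sqrt M + 1 : ℕ) : ℝ) ^ 2 := by exact_mod_cast Nat.lt_succ_sqrt' M
  calc Real.sqrt M < Real.sqrt (((Nat.sqrt M + 1 : ℕ) : ℝ) ^ 2) := Real.sqrt_lt_sqrt (Nat.cast_nonneg _) h
    _ = ((Nat.sqrt M + 1 : ℕ) : ℝ) := Real.sqrt_sq (Nat.cast_nonneg _)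

/-- TRIVIAL BOUND in the crux's window: `|T_j(n,n';c,M)| ≤ 3·M^{3/2}` for `j ≥ ⌊√M⌋+1` — the crux's
conclusion with `ϑ = 3/4` holds for free; everything between `3/4 + ϑ`, `ϑ < 1/4`, and `3/2` is open. -/
theorem trivial_bound (c : ℤ) (n n' M j : ℕ) (hj : Nat.sqrt M + 1 ≤ j) :
    |T c n n' M j| ≤ 3 * (M : ℝ) ^ (3 / 2 : ℝ) := by
  have hj1 : 1 ≤ j := le_trans (by omega) hj
  have h0 := abs_cosetW_le (u n c) (u n' c) (abs_u_le_one n c) (abs_u_le_one n' c) M j hj1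
  unfold T
  rcases Nat.eq_zero_or_pos M with hM | hM
  · subst hM
    simp only [CharP.cast_eq_zero, mul_zero] at h0
    have : (3 : ℝ) * (0 : ℝ) ^ (3 / 2 : ℝ) = 0 := by
      rw [Real.zero_rpow (by norm_num)]; ring
    rw [Nat.cast_zero, this]
    exact h0
  · have hMr : (0 : ℝ) < M := by exact_mod_cast hM
    have hM1 : (1 : ℝ) ≤ M := by exact_mod_cast hM
    have hsqrt_pos : 0 < Real.sqrt M := Real.sqrt_pos.mpr hMr
    have hsqrt_one : 1 ≤ Real.sqrt M := by
      rw [show (1 : ℝ) = Real.sqrt 1 by simp]; exact Real.sqrt_le_sqrt hM1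
    have hjr : Real.sqrt M ≤ (j : ℝ) := by
      have h1 := sqrt_lt_natSqrt_add_one M
      have h2 : ((Nat.sqrt M + 1 : ℕ) : ℝ) ≤ j := by exact_mod_cast hj
      linarith
    have hdiv : 2 * (M : ℝ) / j ≤ 2 * Real.sqrt M := by
      calc 2 * (M : ℝ) / j ≤ 2 * (M : ℝ) / Real.sqrt M :=
            div_le_div_of_nonneg_left (by positivity) hsqrt_pos hjr
        _ = 2 * Real.sqrt M := by rw [mul_div_assoc, Real.div_sqrt]
    have hpow : (M : ℝ) ^ (3 / 2 : ℝ) = M * Real.sqrt M := by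
      rw [show (3 / 2 : ℝ) = 1 + 1 / 2 by norm_num, Real.rpow_add hMr, Real.rpow_one,
        Real.sqrt_eq_rpow]
    calc |cosetW (u n c) (u n' c) M j| ≤ (2 * (M : ℝ) / j + 1) * M := h0
      _ ≤ (2 * Real.sqrt M + Real.sqrt M) * M := by
          refine mul_le_mul_of_nonneg_right ?_ hMr.le
          linarith
      _ = 3 * (M : ℝ) ^ (3 / 2 : ℝ) := by rw [hpow]; ring

/-! ## §4 Natural strengthenings -/

/-- (b) ALL MODULI.  At `j = 1` the coset is the whole square and `T_1 = S(n)·S(n')`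
(random size `M = M^{3/4+1/4}`): the lower end `j ≥ ⌊√M⌋+1` of the window is not decoration. -/
theorem pairs_one (M : ℕ) : pairs M 1 = Ioc M (2 * M) ×ˢ Ioc M (2 * M) := by
  unfold pairs
  exact filter_true_of_mem fun p _ => Nat.modEq_one

/-- `j = 1`: the coset sum is the product of the two block sums. -/
theorem modulus_one (f g : ℕ → ℝ) (M : ℕ) :
    cosetW f g M 1 = (∑ m ∈ Ioc M (2 * M), f m) * (∑ m ∈ Ioc M (2 * M), g m) := by
  unfold cosetW
  rw [pairs_one, sum_product, sum_mul_sum]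

/-- (c) NO UPPER LIMIT ON `j`.  For `j > M` two elements of `(M,2M]` congruent mod `j` are equal, so the
coset is the diagonal … -/
theorem pairs_eq_diag_of_lt (M j : ℕ) (hj : M < j) :
    pairs M j = (Ioc M (2 * M)).map ⟨fun m => (m, m), fun _ _ h => (Prod.ext_iff.mp h).1⟩ := by
  ext ⟨m, m'⟩
  simp only [pairs, mem_filter, mem_product, mem_Ioc, mem_map, Function.Embedding.coeFn_mk,
    Prod.mk.injEq]
  constructor
  · rintro ⟨⟨⟨hm1, hm2⟩, ⟨hm1', hm2'⟩⟩, hmod⟩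
    have key : m = m' := by
      rcases le_total m m' with h | h
      · have hd : j ∣ m' - m := (Nat.modEq_iff_dvd' h).mp hmod
        have hlt : m' - m < j := by omega
        have := Nat.eq_zero_of_dvd_of_lt hd hlt
        omega
      · have hd : j ∣ m - m' := (Nat.modEq_iff_dvd' h).mp hmod.symm
        have hlt : m - m' < j := by omega
        have := Nat.eq_zero_of_dvd_of_lt hd hlt
        omega
    exact ⟨m, ⟨hm1, hm2⟩, rfl, key⟩
  · rintro ⟨a, ⟨ha1, ha2⟩, rfl, rfl⟩
    exact ⟨⟨⟨ha1, ha2⟩, ⟨ha1, ha2⟩⟩, Nat.ModEq.refl _⟩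

/-- … and the coset sum IS the dilated two-point (Chowla) sum `Σ_m f(m) g(m)`: extending the window to all
large `j` turns the crux into a pointwise form of the node `DilatedChowla`. -/
theorem large_modulus_eq_diagonal (f g : ℕ → ℝ) (M j : ℕ) (hj : M < j) :
    cosetW f g M j = ∑ m ∈ Ioc M (2 * M), f m * g m := by
  unfold cosetW
  rw [pairs_eq_diag_of_lt M j hj, sum_map]
  rfl

/-- (a) SMALL MODEL.  At `M = 2`, `j = 2`: `P_2(2) = {(3,3),(4,4)}`. -/
theorem pairs_two_two : pairs 2 2 = {(3, 3), (4, 4)} := by decide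

/-- `T_2(1,2;c=1,M=2) = λ(4)λ(7) + λ(5)λ(9) = −2`. -/
theorem T_small : T 1 1 2 2 2 = -2 := by
  have l2 : ArithmeticFunction.liouville 2 = -1 := by
    rw [ArithmeticFunction.liouville_apply (by norm_num),
      ArithmeticFunction.cardFactors_apply_prime Nat.prime_two]; norm_num
  have l3 : ArithmeticFunction.liouville 3 = -1 := by
    rw [ArithmeticFunction.liouville_apply (by norm_num),
      ArithmeticFunction.cardFactors_apply_prime Nat.prime_three]; norm_num
  have l4 : ArithmeticFunction.liouville 4 = 1 := by
    rw [show (4 : ℕ) = 2 * 2 by norm_num, ArithmeticFunction.liouville_apply_mul, l2]; norm_num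
  have l5 : ArithmeticFunction.liouville 5 = -1 := by
    rw [ArithmeticFunction.liouville_apply (by norm_num),
      ArithmeticFunction.cardFactors_apply_prime Nat.prime_five]; norm_num
  have l7 : ArithmeticFunction.liouville 7 = -1 := by
    rw [ArithmeticFunction.liouville_apply (by norm_num),
      ArithmeticFunction.cardFactors_apply_prime (by norm_num : Nat.Prime 7)]; norm_num
  have l9 : ArithmeticFunction.liouville 9 = 1 := by
    rw [show (9 : ℕ) = 3 * 3 by norm_num, ArithmeticFunction.liouville_apply_mul, l3]; norm_num
  have e : ∀ k : ℕ, Int.toNat ((k : ℤ)) = k := fun k => Int.toNat_natCast k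
  unfold T cosetW
  rw [pairs_two_two, sum_pair (by decide)]
  simp only [u]
  norm_num
  rw [show (4 : ℤ) = ((4 : ℕ) : ℤ) by norm_num, show (7 : ℤ) = ((7 : ℕ) : ℤ) by norm_num,
    show (5 : ℤ) = ((5 : ℕ) : ℤ) by norm_num, show (9 : ℤ) = ((9 : ℕ) : ℤ) by norm_num, e, e, e, e,
    l4, l7, l5, l9]
  norm_num

/-- The UNIFORM-CONSTANT strengthening (`C = 1`, `ϑ = 0`, all `M ≥ 1`) is false already at `M = 2`
(`|T| = 2 > 2^{3/4}`): constants are genuinely needed; nothing deeper. -/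
theorem not_uniformConstant :
    ¬ (∀ M n n' j : ℕ, 1 ≤ n → 1 ≤ n' → n ≠ n' → n ≤ 2 * M → n' ≤ 2 * M →
        Nat.sqrt M + 1 ≤ j → j < 2 * (Nat.sqrt M + 1) → |T 1 n n' M j| ≤ (M : ℝ) ^ (3 / 4 : ℝ)) := by
  intro h
  have hs : Nat.sqrt 2 = 1 := by norm_num
  have := h 2 1 2 2 le_rfl (by norm_num) (by norm_num) (by norm_num) (by norm_num) (by rw [hs]) (by rw [hs]; norm_num)
  rw [T_small] at this
  have h2 : (2 : ℝ) ^ (3 / 4 : ℝ) < 2 := by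
    calc (2 : ℝ) ^ (3 / 4 : ℝ) < (2 : ℝ) ^ (1 : ℝ) :=
          Real.rpow_lt_rpow_of_exponent_lt (by norm_num) (by norm_num)
      _ = 2 := Real.rpow_one 2
  norm_num at this
  linarith

/-- (vii) SHIFT SCALING.  `λ(m·gn + gc) = λ(g)·λ(mn + c)`: scaling shift and dilation together pulls out `λ(g)`. -/
theorem u_scale (g n : ℕ) (c : ℤ) (m : ℕ) :
    u (g * n) ((g : ℤ) * c) m = (ArithmeticFunction.liouville g : ℝ) * u n c m := by
  unfold u
  rw [show (m : ℤ) * ((g * n : ℕ) : ℤ) + (g : ℤ) * c = (g : ℤ) * ((m : ℤ) * n + c) by push_cast; ring,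
    toNat_natCast_mul, ArithmeticFunction.liouville_apply_mul]
  push_cast; ring

/-- … hence `T_j(gn, gn'; gc) = T_j(n, n'; c)` for `g ≥ 1`: the crux at ONE shift `c₀` contains the crux at the shift
`sign c₀` for all dilations `≤ 2M/|c₀|`, and the crux at shift `±1` gives every other shift on the dilations divisible
by `|c|`.  The shifts `c = ±1` are the hardest instances; `∀ c` adds only the non-divisible dilations. -/
theorem T_scale {g : ℕ} (hg : 1 ≤ g) (c : ℤ) (n n' M j : ℕ) :
    T ((g : ℤ) * c) (g * n) (g * n') M j = T c n n' M j := by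
  have hsq : (ArithmeticFunction.liouville g : ℝ) * (ArithmeticFunction.liouville g : ℝ) = 1 := by
    rw [ArithmeticFunction.liouville_apply (by omega)]; push_cast
    rw [← pow_add, ← two_mul, pow_mul, neg_one_sq, one_pow]
  unfold T cosetW
  refine sum_congr rfl fun p _ => ?_
  rw [u_scale, u_scale]
  calc (ArithmeticFunction.liouville g : ℝ) * u n c p.1 * ((ArithmeticFunction.liouville g : ℝ) * u n' c p.2)
      = ((ArithmeticFunction.liouville g : ℝ) * (ArithmeticFunction.liouville g : ℝ)) * (u n c p.1 * u n' c p.2) := by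
        ring
    _ = u n c p.1 * u n' c p.2 := by rw [hsq, one_mul]

end Summit.Parity.GeneralizedHardyLittlewood.Theorems.CosetDecorrelation.Negative
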